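import Literature.Probability.Percolation.VoronoiContinuumCrossings
import Literature.Topology.PlaneTopology.GateCrossing
import HarnessLib

/-!
# Tassion's RSW theory for Voronoi percolation, I: the events `H_s(α, β)`, the level `α_s`,
# the four-legged event `X_s(α)`, chaining, and the annulus event

Topic `Probability/Percolation`; everything is proved, no named fact is introduced.  This file and
its sequels formalise §§2–3 of V. Tassion, *Crossing probabilities for Voronoi percolation*,
Ann. Probab. 44 (2016) [Tassion2016] for WEAK-black CONTINUUM crossings of annealed two-colour
Poisson–Voronoi percolation at `p = 1/2` (events `blackCross` of `VoronoiContinuumCrossings.lean`),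
with the following faithful-but-formal adjustments, each flagged at its place:

* `H_s(α, β)` (`hEv s α β`) is the event of a weak-black continuum in the square
  `B_{s/2} = [-s/2, s/2]²` meeting the left side and the segment `{s/2} × [α, β]`;
  `ψ_s(α) = P[H_s(α, s/2)]` (`psiF`).
* Tassion defines `α_s = min(φ_s⁻¹(c₀/4), s/4)` using continuity and strict monotonicity of
  `φ_s(α) = P[H_s(0,α)] - P[H_s(α,s/2)]` ("one can verify").  We use instead
  `α_s = sup {α ∈ [0, s/4] : ψ_s(α) ≥ c₀/8}` (`alphaS`; `c₀ = 1/2` here, `c₀/8 = 1/16`), which needs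
  only the monotonicity of `ψ_s` and its LEFT-CONTINUITY, a consequence of compactness (cut-wire
  theorem: `exists_forall_not_mem_blackCross`).  The two properties of Lemma 2.1 then hold in the
  form: (P1) `ψ_s(α) ≥ 1/16` for all `α ≤ α_s` (`psiF_alphaS_ge`), hence `P[X_s(α)] ≥ c₁`
  (`measureReal_xEv_ge`); (P2) if `α_s < s/4` then `P[H_s(0, α)] ≥ 3/16 ≥ c₀/4 + …` for all
  `α ≥ α_s` (`measureReal_hEv_zero_ge`, right-continuity at `α_s`) and
  `P[H_s(0,α)] - P[H_s(α,s/2)] ≥ 1/8 = c₀/4` for all `α > α_s` (`measureReal_hEv_diff_ge`).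
* `X_s(α)` is realised as the INTERSECTION `xEv s α` of the four symmetric copies of `H_s(α, s/2)`
  with a top–bottom crossing of the square (Tassion's sub-event in the proof of Lemma 2.1); it
  produces one weak-black continuum in the square touching the four corner segments
  (`exists_fourLegs_of_mem_xEv`, by the crossing lemma `inter_nonempty_of_crossing_continua`).
* The circuit event `A_s` is replaced by the intersection `annEv s` of the four long crossings of
  the rectangles of `[-2s, 2s]² ∖ (-s, s)²` (so Cor. 1.3 (3), `P[A_s] ≥ f_s(4)⁴`, is FKG), whose
  deterministic content is a pair of "hooks" (`exists_hooks_of_mem_annEv`) used with the gate lemma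
  (`GateCrossing.lean`) where Tassion uses a circuit.
* Cor. 1.3 (2), `f_s(1 + iκ) ≥ f_s(1 + κ)^i f_s(1)^{i-1}`, is `measureReal_lrCross_chain`.

## References

* V. Tassion, Ann. Probab. 44 (2016) 3385–3398, §1.2 (Cor. 1.3), §2 (Lemma 2.1). [Tassion2016]
-/

noncomputable section

namespace Literature.Probability.Percolation

open _root_.MeasureTheory _root_.ProbabilityTheory _root_.Filter _root_.Set _root_.Metric Complex
open scoped _root_.Topology _root_.ENNReal _root_.NNReal
open Literature.Analysis.FunctionSpaces
open Literature.Topology.PlaneTopology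

/-- The configuration-pair space of two-coloured nuclei. -/
local notation "Ω₂" => PointConfig ℂ × PointConfig ℂ

/-! ### Semicontinuity of crossing events in the target (cut-wire theorem) -/

section Semicontinuity

/-- **Crossing events are upper semicontinuous in the target.**  If no weak-black continuum in the
compact `R` joins the closed set `A` to the compact set `A₀`, then none joins `A` to any set
inside a small thickening of `A₀`: cut the compact set of black points of `R` into a closed part
containing its `A`-points and a closed part containing its `A₀`-points (cut-wire theorem
`exists_closed_separation`) and separate them by thickenings. [folklore] -/
theorem exists_forall_not_mem_blackCross {R A A₀ : Set ℂ} (hR : IsCompact R) (hA : IsClosed A)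
    (hA₀ : IsCompact A₀) {ω : Ω₂} (hω : ω ∉ blackCross R A A₀) :
    ∃ δ > 0, ∀ A' : Set ℂ, A' ⊆ thickening δ A₀ → ω ∉ blackCross R A A' := by
  set Z : Set ℂ := blackRegion ((ω.1 : PointConfig ℂ) : Set ℂ) ((ω.2 : PointConfig ℂ) : Set ℂ) ∩ R
    with hZ
  have hZc : IsCompact Z := hR.inter_left (isClosed_blackRegion _ _)
  have hno : ∀ C ⊆ Z, IsPreconnected C → (C ∩ A).Nonempty → (C ∩ A₀).Nonempty → False := by
    intro C hC hCp ⟨x, hx, hxA⟩ ⟨y, hy, hyA⟩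
    have hcl : closure C ⊆ Z := closure_minimal hC hZc.isClosed
    exact hω ⟨closure C, hcl, hZc.of_isClosed_subset isClosed_closure hcl, hCp.closure,
      ⟨x, subset_closure hx, hxA⟩, ⟨y, subset_closure hy, hyA⟩⟩
  obtain ⟨Z₁, Z₂, hZ₁, hZ₂, hdisj, hunion, hZ₁B, hZ₂A⟩ :=
    exists_closed_separation hZc hA hA₀.isClosed hno
  have hZ₁c : IsCompact Z₁ := hZc.of_isClosed_subset hZ₁ (hunion ▸ subset_union_left)
  obtain ⟨δ₁, hδ₁, hδ₁d⟩ := hZ₁B.exists_thickenings hZ₁c hA₀.isClosed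
  obtain ⟨δ₂, hδ₂, hδ₂d⟩ := hdisj.exists_thickenings hZ₁c hZ₂
  refine ⟨δ₁, hδ₁, fun A' hA' => ?_⟩
  rintro ⟨C, hC, -, hCp, ⟨x, hxC, hxA⟩, ⟨y, hyC, hyA'⟩⟩
  have hCZ : C ⊆ Z₁ ∪ Z₂ := by rw [hunion]; exact hC
  have hCsub : C ⊆ thickening δ₂ Z₁ ∪ thickening δ₂ Z₂ := fun w hw =>
    (hCZ hw).elim (fun h => Or.inl (self_subset_thickening hδ₂ _ h))
      (fun h => Or.inr (self_subset_thickening hδ₂ _ h))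
  have hxZ₁ : x ∈ Z₁ := (hCZ hxC).elim id fun h => absurd hxA (Set.disjoint_left.1 hZ₂A h)
  have hC₁ : C ⊆ thickening δ₂ Z₁ :=
    hCp.subset_left_of_subset_union isOpen_thickening isOpen_thickening hδ₂d hCsub
      ⟨x, hxC, self_subset_thickening hδ₂ _ hxZ₁⟩
  have hyZ₁ : y ∈ Z₁ := (hCZ hyC).elim id fun h =>
    absurd (self_subset_thickening hδ₂ _ h) (Set.disjoint_left.1 hδ₂d (hC₁ hyC))
  exact Set.disjoint_left.1 hδ₁d (self_subset_thickening hδ₁ _ hyZ₁) (hA' hyA')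

end Semicontinuity

/-! ### The square `B_{s/2}`, its side segments, and the events `H_s(α, β)` -/

section HEvents

/-- The square `B_{s/2} = [-s/2, s/2]²`. [cite: Tassion2016, §1.1] -/
def sqr (s : ℝ) : Set ℂ := cRect (-(s / 2)) (s / 2) (-(s / 2)) (s / 2)

/-- The segment `{s/2} × [α, β]` of the right side of `B_{s/2}`. [cite: Tassion2016, §2] -/
def rseg (s α β : ℝ) : Set ℂ := {z : ℂ | z.re = s / 2 ∧ α ≤ z.im ∧ z.im ≤ β}

/-- The segment `{-s/2} × [α, β]` of the left side of `B_{s/2}`. [cite: Tassion2016, §2] -/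
def lseg (s α β : ℝ) : Set ℂ := {z : ℂ | z.re = -(s / 2) ∧ α ≤ z.im ∧ z.im ≤ β}

variable {s α β α' β' : ℝ}

/-- The square is compact. [folklore] -/
theorem isCompact_sqr (s : ℝ) : IsCompact (sqr s) := isCompact_cRect _ _ _ _

/-- Membership in the square. [folklore] -/
theorem mem_sqr {z : ℂ} : z ∈ sqr s ↔ (-(s / 2) ≤ z.re ∧ z.re ≤ s / 2) ∧ -(s / 2) ≤ z.im ∧ z.im ≤ s / 2 :=
  mem_cRect

/-- Side segments are closed. [folklore] -/
theorem isClosed_rseg (s α β : ℝ) : IsClosed (rseg s α β) :=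
  (isClosed_eq continuous_re continuous_const).inter
    ((isClosed_le continuous_const continuous_im).inter (isClosed_le continuous_im continuous_const))

/-- Side segments are closed. [folklore] -/
theorem isClosed_lseg (s α β : ℝ) : IsClosed (lseg s α β) :=
  (isClosed_eq continuous_re continuous_const).inter
    ((isClosed_le continuous_const continuous_im).inter (isClosed_le continuous_im continuous_const))

/-- Side segments are compact. [folklore] -/
theorem isCompact_rseg (s α β : ℝ) : IsCompact (rseg s α β) := by
  refine (isCompact_cRect (s / 2) (s / 2) α β).of_isClosed_subset (isClosed_rseg s α β) ?_
  rintro z ⟨h1, h2, h3⟩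
  exact mem_cRect.2 ⟨⟨h1.ge, h1.le⟩, h2, h3⟩

/-- **Tassion's event `H_s(α, β)`** (continuum form): a weak-black continuum in `B_{s/2}` meeting
the left side and the right segment `{s/2} × [α, β]`. [cite: Tassion2016, §2] -/
def hEv (s α β : ℝ) : Set Ω₂ := blackCross (sqr s) {z | z.re = -(s / 2)} (rseg s α β)

/-- `H_s(α, β)` is measurable. [folklore] -/
theorem measurableSet_hEv (s α β : ℝ) : MeasurableSet (hEv s α β) :=
  measurableSet_blackCross (isCompact_sqr s) (isClosed_setOf_re_eq _) (isClosed_rseg s α β)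

/-- `H_s(α, β)` is good-increasing. [cite: Tassion2016, §1.2] -/
theorem isGoodIncreasing_hEv (s α β : ℝ) : IsGoodIncreasing (hEv s α β) :=
  isGoodIncreasing_blackCross _ _ _

/-- `H_s(α, β)` is monotone in the target segment. [cite: Tassion2016, §2] -/
theorem hEv_mono (h1 : α' ≤ α) (h2 : β ≤ β') : hEv s α β ⊆ hEv s α' β' :=
  blackCross_mono Subset.rfl Subset.rfl fun _ ⟨hz1, hz2, hz3⟩ => ⟨hz1, h1.trans hz2, hz3.trans h2⟩

/-- A left–right crossing of the square lands in the lower or in the upper half of the right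
side. [cite: Tassion2016, §2 ("symmetry implies …")] -/
theorem lrCross_sqr_subset (s : ℝ) :
    lrCross (-(s / 2)) (s / 2) (-(s / 2)) (s / 2) ⊆ hEv s (-(s / 2)) 0 ∪ hEv s 0 (s / 2) := by
  rintro ω ⟨C, hC, hCc, hCp, hCA, ⟨y, hyC, hyre⟩⟩
  have hyR := (mem_cRect.1 (hC hyC).2)
  rcases le_total y.im 0 with h | h
  · exact Or.inl ⟨C, hC, hCc, hCp, hCA, ⟨y, hyC, hyre, hyR.2.1, h⟩⟩
  · exact Or.inr ⟨C, hC, hCc, hCp, hCA, ⟨y, hyC, hyre, h, hyR.2.2⟩⟩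

/-- Complex conjugation maps the square to itself. [folklore] -/
theorem preimage_conjLIE_sqr (s : ℝ) : conjLIE ⁻¹' sqr s = sqr s := by
  ext z
  simp only [mem_preimage, mem_sqr, conjLIE_apply, conj_re, conj_im]
  constructor <;> rintro ⟨h1, h2, h3⟩ <;> exact ⟨h1, by linarith, by linarith⟩

/-- Complex conjugation fixes vertical lines. [folklore] -/
theorem preimage_conjLIE_setOf_re_eq (a : ℝ) : conjLIE ⁻¹' {z : ℂ | z.re = a} = {z : ℂ | z.re = a} := by
  ext z; simp

/-- Complex conjugation reflects right segments. [folklore] -/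
theorem preimage_conjLIE_rseg (s α β : ℝ) : conjLIE ⁻¹' rseg s α β = rseg s (-β) (-α) := by
  ext z
  simp only [mem_preimage, rseg, mem_setOf_eq, conjLIE_apply, conj_re, conj_im]
  constructor <;> rintro ⟨h1, h2, h3⟩ <;> exact ⟨h1, by linarith, by linarith⟩

variable {PB PW : Measure (PointConfig ℂ)}

/-- By reflection in the real axis, landing in the lower half is as likely as landing in the
upper half. [cite: Tassion2016, §2] -/
theorem measure_hEv_lower_eq (hB : IsPoissonPointProcess (volume : Measure ℂ) PB)
    (hW : IsPoissonPointProcess (volume : Measure ℂ) PW) (s : ℝ) :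
    (PB.prod PW) (hEv s (-(s / 2)) 0) = (PB.prod PW) (hEv s 0 (s / 2)) := by
  have h := measure_blackCross_preimage_linearIsometryEquiv hB hW conjLIE (sqr s)
    {z | z.re = -(s / 2)} (rseg s 0 (s / 2))
  rw [preimage_conjLIE_sqr, preimage_conjLIE_setOf_re_eq, preimage_conjLIE_rseg, neg_zero] at h
  exact h

/-- **`P[H_s(0, s/2)] ≥ c₀/2 = 1/4`** (the square crossing bound `c₀ = 1/2` and symmetry).
[cite: Tassion2016, §2 ("symmetry implies φ_s(s/2) ≥ c₀/2")] -/
theorem measureReal_hEv_zero_half_ge (hB : IsPoissonPointProcess (volume : Measure ℂ) PB)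
    (hW : IsPoissonPointProcess (volume : Measure ℂ) PW) (hs : 0 < s) :
    1 / 4 ≤ (PB.prod PW).real (hEv s 0 (s / 2)) := by
  haveI := hB.isProbabilityMeasure; haveI := hW.isProbabilityMeasure
  have h1 := half_le_measureReal_lrCross_square hB hW (a := -(s / 2)) (b := s / 2) (c := -(s / 2))
    (d := s / 2) (by linarith) rfl
  have h2 : (PB.prod PW).real (lrCross (-(s / 2)) (s / 2) (-(s / 2)) (s / 2)) ≤
      (PB.prod PW).real (hEv s (-(s / 2)) 0) + (PB.prod PW).real (hEv s 0 (s / 2)) :=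
    (measureReal_mono (lrCross_sqr_subset s) (measure_ne_top _ _)).trans (measureReal_union_le _ _)
  have h3 : (PB.prod PW).real (hEv s (-(s / 2)) 0) = (PB.prod PW).real (hEv s 0 (s / 2)) := by
    rw [measureReal_def, measureReal_def, measure_hEv_lower_eq hB hW]
  linarith

/-- Splitting the target: `H_s(0, s/2) ⊆ H_s(0, α) ∪ H_s(α, s/2)`. [cite: Tassion2016, proof of Lemma 2.1] -/
theorem hEv_zero_half_subset (s α : ℝ) : hEv s 0 (s / 2) ⊆ hEv s 0 α ∪ hEv s α (s / 2) := by
  rintro ω ⟨C, hC, hCc, hCp, hCA, ⟨y, hyC, hyre, hy0, hys⟩⟩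
  rcases le_total y.im α with h | h
  · exact Or.inl ⟨C, hC, hCc, hCp, hCA, ⟨y, hyC, hyre, hy0, h⟩⟩
  · exact Or.inr ⟨C, hC, hCc, hCp, hCA, ⟨y, hyC, hyre, h, hys⟩⟩

end HEvents

/-! ### The function `ψ_s` and the level `α_s` -/

section AlphaS

variable {PB PW : Measure (PointConfig ℂ)} {s α β : ℝ}

/-- `ψ_s(α) = P[H_s(α, s/2)]`. [cite: Tassion2016, §2 eq. (6)] -/
def psiF (μ : Measure Ω₂) (s α : ℝ) : ℝ := μ.real (hEv s α (s / 2))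

/-- The good levels: `α ∈ [0, s/4]` with `ψ_s(α) ≥ c₀/8 = 1/16`. [cite: Tassion2016, Lemma 2.1] -/
def goodLevels (μ : Measure Ω₂) (s : ℝ) : Set ℝ := {α | 0 ≤ α ∧ α ≤ s / 4 ∧ 1 / 16 ≤ psiF μ s α}

/-- **The level `α_s`**: the supremum of the good levels (replacing Tassion's
`min(φ_s⁻¹(c₀/4), s/4)`, see the module docstring). [cite: Tassion2016, Lemma 2.1 eq. (7)] -/
def alphaS (μ : Measure Ω₂) (s : ℝ) : ℝ := sSup (goodLevels μ s)

/-- `ψ_s` is non-increasing. [cite: Tassion2016, §2] -/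
theorem psiF_antitone (μ : Measure Ω₂) [IsFiniteMeasure μ] (s : ℝ) (h : α ≤ β) :
    psiF μ s β ≤ psiF μ s α :=
  measureReal_mono (hEv_mono h le_rfl) (measure_ne_top _ _)

/-- The good levels are bounded above by `s/4`. [folklore] -/
theorem bddAbove_goodLevels (μ : Measure Ω₂) (s : ℝ) : BddAbove (goodLevels μ s) :=
  ⟨s / 4, fun _ h => h.2.1⟩

/-- `0` is a good level. [cite: Tassion2016, Lemma 2.1] -/
theorem zero_mem_goodLevels (hB : IsPoissonPointProcess (volume : Measure ℂ) PB)
    (hW : IsPoissonPointProcess (volume : Measure ℂ) PW) (hs : 0 < s) :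
    (0 : ℝ) ∈ goodLevels (PB.prod PW) s :=
  ⟨le_rfl, by linarith, (by norm_num : (1 : ℝ) / 16 ≤ 1 / 4).trans (measureReal_hEv_zero_half_ge hB hW hs)⟩

/-- `0 ≤ α_s`. [cite: Tassion2016, Lemma 2.1] -/
theorem alphaS_nonneg (hB : IsPoissonPointProcess (volume : Measure ℂ) PB)
    (hW : IsPoissonPointProcess (volume : Measure ℂ) PW) (hs : 0 < s) : 0 ≤ alphaS (PB.prod PW) s :=
  le_csSup (bddAbove_goodLevels _ s) (zero_mem_goodLevels hB hW hs)

/-- `α_s ≤ s/4`. [cite: Tassion2016, Lemma 2.1] -/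
theorem alphaS_le (hB : IsPoissonPointProcess (volume : Measure ℂ) PB)
    (hW : IsPoissonPointProcess (volume : Measure ℂ) PW) (hs : 0 < s) : alphaS (PB.prod PW) s ≤ s / 4 :=
  csSup_le ⟨0, zero_mem_goodLevels hB hW hs⟩ fun _ h => h.2.1

/-- Levels below `α_s` are good. [folklore] -/
theorem mem_goodLevels_of_lt_alphaS (hB : IsPoissonPointProcess (volume : Measure ℂ) PB)
    (hW : IsPoissonPointProcess (volume : Measure ℂ) PW) (hs : 0 < s) (h0 : 0 ≤ β)
    (hβ : β < alphaS (PB.prod PW) s) : β ∈ goodLevels (PB.prod PW) s := by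
  haveI := hB.isProbabilityMeasure; haveI := hW.isProbabilityMeasure
  obtain ⟨α, hα, hβα⟩ := exists_lt_of_lt_csSup ⟨0, zero_mem_goodLevels hB hW hs⟩ hβ
  exact ⟨h0, hβα.le.trans hα.2.1, hα.2.2.trans (psiF_antitone _ s hβα.le)⟩

/-- Segments shrinking from below converge in the Hausdorff sense. [folklore] -/
theorem rseg_subset_thickening_of_lt {s α₀ β δ : ℝ} (hδ : 0 < δ) (hα₀ : α₀ ≤ s / 2) (hβ : α₀ - δ < β) :
    rseg s β (s / 2) ⊆ thickening δ (rseg s α₀ (s / 2)) := by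
  rintro z ⟨hz1, hz2, hz3⟩
  by_cases h : α₀ ≤ z.im
  · exact self_subset_thickening hδ _ ⟨hz1, h, hz3⟩
  · rw [not_le] at h
    refine mem_thickening_iff.2 ⟨⟨s / 2, α₀⟩, ⟨rfl, le_rfl, hα₀⟩, ?_⟩
    rw [dist_comm, Complex.dist_eq, Complex.norm_eq_sqrt_sq_add_sq]
    simp only [sub_re, sub_im, hz1, sub_self, ne_eq, OfNat.ofNat_ne_zero, not_false_eq_true,
      zero_pow, zero_add]
    rw [Real.sqrt_sq (by linarith)]
    linarith

/-- Segments shrinking from above converge in the Hausdorff sense. [folklore] -/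
theorem rseg_zero_subset_thickening_of_lt {s α₀ β δ : ℝ} (hδ : 0 < δ) (hα₀ : 0 ≤ α₀) (hβ : β < α₀ + δ) :
    rseg s 0 β ⊆ thickening δ (rseg s 0 α₀) := by
  rintro z ⟨hz1, hz2, hz3⟩
  by_cases h : z.im ≤ α₀
  · exact self_subset_thickening hδ _ ⟨hz1, hz2, h⟩
  · rw [not_le] at h
    refine mem_thickening_iff.2 ⟨⟨s / 2, α₀⟩, ⟨rfl, hα₀, le_rfl⟩, ?_⟩
    rw [Complex.dist_eq, Complex.norm_eq_sqrt_sq_add_sq]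
    simp only [sub_re, sub_im, hz1, sub_self, ne_eq, OfNat.ofNat_ne_zero, not_false_eq_true,
      zero_pow, zero_add]
    rw [Real.sqrt_sq (by linarith)]
    linarith

/-- **Left-continuity of `ψ_s` (compactness)**: `H_s(α₀, s/2) ⊇ ⋂ₙ H_s(βₙ, s/2)` for any
sequence `βₙ → α₀` from below. [folklore] -/
theorem iInter_hEv_subset_of_tendsto {s α₀ : ℝ} (hα₀ : α₀ ≤ s / 2) {βseq : ℕ → ℝ}
    (hβ : Tendsto βseq atTop (𝓝 α₀)) : (⋂ n, hEv s (βseq n) (s / 2)) ⊆ hEv s α₀ (s / 2) := by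
  intro ω hω
  by_contra hnot
  obtain ⟨δ, hδ, hfar⟩ := exists_forall_not_mem_blackCross (isCompact_sqr s)
    (isClosed_setOf_re_eq _) (isCompact_rseg s α₀ (s / 2)) hnot
  obtain ⟨n, hn⟩ := (eventually_atTop.1 (hβ.eventually (lt_mem_nhds (show α₀ - δ < α₀ by linarith))))
  exact hfar _ (rseg_subset_thickening_of_lt hδ hα₀ (hn n le_rfl)) (mem_iInter.1 hω n)

/-- **Right-continuity of `α ↦ P[H_s(0, α)]` (compactness)**: `H_s(0, α₀) ⊇ ⋂ₙ H_s(0, βₙ)` for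
any sequence `βₙ → α₀`. [folklore] -/
theorem iInter_hEv_zero_subset_of_tendsto {s α₀ : ℝ} (hα₀ : 0 ≤ α₀) {βseq : ℕ → ℝ}
    (hβ : Tendsto βseq atTop (𝓝 α₀)) : (⋂ n, hEv s 0 (βseq n)) ⊆ hEv s 0 α₀ := by
  intro ω hω
  by_contra hnot
  obtain ⟨δ, hδ, hfar⟩ := exists_forall_not_mem_blackCross (isCompact_sqr s)
    (isClosed_setOf_re_eq _) (isCompact_rseg s 0 α₀) hnot
  obtain ⟨n, hn⟩ := (eventually_atTop.1 (hβ.eventually (gt_mem_nhds (show α₀ < α₀ + δ by linarith))))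
  exact hfar _ (rseg_zero_subset_thickening_of_lt hδ hα₀ (hn n le_rfl)) (mem_iInter.1 hω n)

/-- **(P1) at the level `α_s` itself**: `ψ_s(α_s) ≥ 1/16` (left-continuity of `ψ_s`).
[cite: Tassion2016, Lemma 2.1 (P1)] -/
theorem psiF_alphaS_ge (hB : IsPoissonPointProcess (volume : Measure ℂ) PB)
    (hW : IsPoissonPointProcess (volume : Measure ℂ) PW) (hs : 0 < s) :
    1 / 16 ≤ psiF (PB.prod PW) s (alphaS (PB.prod PW) s) := by
  haveI := hB.isProbabilityMeasure; haveI := hW.isProbabilityMeasure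
  set μ := PB.prod PW with hμ
  set α₀ := alphaS μ s with hα₀
  have hα₀0 : 0 ≤ α₀ := alphaS_nonneg hB hW hs
  have hα₀s : α₀ ≤ s / 2 := (alphaS_le hB hW hs).trans (by linarith)
  rcases hα₀0.eq_or_lt with h0 | hpos
  · -- `α_s = 0`
    rw [psiF, ← h0]
    exact (by norm_num : (1 : ℝ) / 16 ≤ 1 / 4).trans (measureReal_hEv_zero_half_ge hB hW hs)
  -- `α_s > 0`: approach from below along `βₙ = α₀ (1 - 1/(n+1))`
  set βseq : ℕ → ℝ := fun n => α₀ - α₀ / ((n : ℝ) + 1) with hβseq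
  have hβlt : ∀ n, βseq n < α₀ := fun n => by
    have : 0 < α₀ / ((n : ℝ) + 1) := by positivity
    simp only [hβseq]; linarith
  have hβ0 : ∀ n, 0 ≤ βseq n := fun n => by
    simp only [hβseq]
    rw [sub_nonneg, div_le_iff₀ (by positivity)]
    nlinarith
  have hβmono : Monotone βseq := fun m n hmn => by
    simp only [hβseq]
    have h1 : α₀ / ((n : ℝ) + 1) ≤ α₀ / ((m : ℝ) + 1) :=
      div_le_div_of_nonneg_left hα₀0 (by positivity) (by exact_mod_cast Nat.add_le_add_right hmn 1)
    linarith
  have hβlim : Tendsto βseq atTop (𝓝 α₀) := by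
    have h1 : Tendsto (fun n : ℕ => α₀ / ((n : ℝ) + 1)) atTop (𝓝 0) :=
      tendsto_const_nhds.div_atTop (tendsto_natCast_atTop_atTop.atTop_add tendsto_const_nhds)
    simpa [hβseq] using (tendsto_const_nhds (x := α₀)).sub h1
  -- the events `H_s(βₙ, s/2)` decrease to (a subset of) `H_s(α₀, s/2)`
  set Ev : ℕ → Set Ω₂ := fun n => hEv s (βseq n) (s / 2) with hEvdef
  have hanti : Antitone Ev := fun m n hmn => hEv_mono (hβmono hmn) le_rfl
  have hlim := tendsto_measure_iInter_atTop (μ := μ) (fun n => (measurableSet_hEv s (βseq n) (s / 2)).nullMeasurableSet)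
    hanti ⟨0, measure_ne_top _ _⟩
  have hge : ∀ n, ENNReal.ofReal (1 / 16) ≤ μ (Ev n) := fun n => by
    have hmem := mem_goodLevels_of_lt_alphaS hB hW hs (hβ0 n) (hβlt n)
    have h := hmem.2.2
    rw [psiF, measureReal_def] at h
    exact (ENNReal.ofReal_le_iff_le_toReal (measure_ne_top _ _)).2 h
  have hinter : ENNReal.ofReal (1 / 16) ≤ μ (⋂ n, Ev n) := ge_of_tendsto' hlim fun n => hge n
  have hsub : (⋂ n, Ev n) ⊆ hEv s α₀ (s / 2) := iInter_hEv_subset_of_tendsto hα₀s hβlim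
  rw [psiF, measureReal_def]
  refine (ENNReal.ofReal_le_iff_le_toReal (measure_ne_top _ _)).1 (hinter.trans (measure_mono hsub))

/-- **(P1)**: `ψ_s(α) ≥ 1/16` for every `α ≤ α_s`. [cite: Tassion2016, Lemma 2.1 (P1)] -/
theorem psiF_ge_of_le_alphaS (hB : IsPoissonPointProcess (volume : Measure ℂ) PB)
    (hW : IsPoissonPointProcess (volume : Measure ℂ) PW) (hs : 0 < s) (hα : α ≤ alphaS (PB.prod PW) s) :
    1 / 16 ≤ psiF (PB.prod PW) s α := by
  haveI := hB.isProbabilityMeasure; haveI := hW.isProbabilityMeasure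
  exact (psiF_alphaS_ge hB hW hs).trans (psiF_antitone _ s hα)

/-- **(P2), first half**: if `α_s < s/4` then `ψ_s(α) < 1/16` for `α > α_s`.
[cite: Tassion2016, Lemma 2.1 (P2)] -/
theorem psiF_lt_of_alphaS_lt (hB : IsPoissonPointProcess (volume : Measure ℂ) PB)
    (hW : IsPoissonPointProcess (volume : Measure ℂ) PW) (hs : 0 < s)
    (hlt : alphaS (PB.prod PW) s < s / 4) (h1 : alphaS (PB.prod PW) s < α) :
    psiF (PB.prod PW) s α < 1 / 16 := by
  haveI := hB.isProbabilityMeasure; haveI := hW.isProbabilityMeasure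
  set μ := PB.prod PW
  have key : ∀ γ, alphaS μ s < γ → γ ≤ s / 4 → psiF μ s γ < 1 / 16 := by
    intro γ hγ1 hγ2
    by_contra hge
    rw [not_lt] at hge
    have hmem : γ ∈ goodLevels μ s := ⟨(alphaS_nonneg hB hW hs).trans hγ1.le, hγ2, hge⟩
    have hle : γ ≤ alphaS μ s := le_csSup (bddAbove_goodLevels μ s) hmem
    linarith
  rcases le_or_gt α (s / 4) with h | h
  · exact key α h1 h
  · exact (psiF_antitone μ s h.le).trans_lt (key (s / 4) hlt le_rfl)

/-- **(P2), difference form**: if `α_s < s/4` then `P[H_s(0, α)] - P[H_s(α, s/2)] ≥ 1/8 = c₀/4`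
for `α > α_s`. [cite: Tassion2016, Lemma 2.1 (P2)] -/
theorem measureReal_hEv_diff_ge (hB : IsPoissonPointProcess (volume : Measure ℂ) PB)
    (hW : IsPoissonPointProcess (volume : Measure ℂ) PW) (hs : 0 < s)
    (hlt : alphaS (PB.prod PW) s < s / 4) (h1 : alphaS (PB.prod PW) s < α) :
    1 / 8 ≤ (PB.prod PW).real (hEv s 0 α) - (PB.prod PW).real (hEv s α (s / 2)) := by
  haveI := hB.isProbabilityMeasure; haveI := hW.isProbabilityMeasure
  have hq := measureReal_hEv_zero_half_ge hB hW hs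
  have hsplit : (PB.prod PW).real (hEv s 0 (s / 2)) ≤
      (PB.prod PW).real (hEv s 0 α) + (PB.prod PW).real (hEv s α (s / 2)) :=
    (measureReal_mono (hEv_zero_half_subset s α) (measure_ne_top _ _)).trans (measureReal_union_le _ _)
  have hψ := psiF_lt_of_alphaS_lt hB hW hs hlt h1
  rw [psiF] at hψ
  linarith

/-- **(P2), value form**: if `α_s < s/4` then `P[H_s(0, α)] ≥ 3/16 ≥ c₀/4 + P[H_s(α, s/2)]` for all
`α ≥ α_s` (at `α = α_s` by right-continuity). [cite: Tassion2016, Lemma 2.1 (P2)] -/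
theorem measureReal_hEv_zero_ge (hB : IsPoissonPointProcess (volume : Measure ℂ) PB)
    (hW : IsPoissonPointProcess (volume : Measure ℂ) PW) (hs : 0 < s)
    (hlt : alphaS (PB.prod PW) s < s / 4) (h1 : alphaS (PB.prod PW) s ≤ α) :
    3 / 16 ≤ (PB.prod PW).real (hEv s 0 α) := by
  haveI := hB.isProbabilityMeasure; haveI := hW.isProbabilityMeasure
  set μ := PB.prod PW with hμ
  have hstrict : ∀ γ, alphaS μ s < γ → 3 / 16 ≤ μ.real (hEv s 0 γ) := by
    intro γ hγ1
    have hd := measureReal_hEv_diff_ge hB hW hs hlt hγ1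
    have hψ := psiF_lt_of_alphaS_lt hB hW hs hlt hγ1
    have hq := measureReal_hEv_zero_half_ge hB hW hs
    have hsplit : μ.real (hEv s 0 (s / 2)) ≤ μ.real (hEv s 0 γ) + μ.real (hEv s γ (s / 2)) :=
      (measureReal_mono (hEv_zero_half_subset s γ) (measure_ne_top _ _)).trans (measureReal_union_le _ _)
    rw [psiF] at hψ
    linarith
  rcases h1.lt_or_eq with hlt' | heq
  · exact hstrict α hlt'
  -- `α = α_s`: right-continuity
  set α₀ := alphaS μ s with hα₀
  have hα₀0 : 0 ≤ α₀ := alphaS_nonneg hB hW hs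
  set βseq : ℕ → ℝ := fun n => α₀ + (s / 4 - α₀) / ((n : ℝ) + 1) with hβseq
  have hgap : 0 < s / 4 - α₀ := by linarith
  have hβgt : ∀ n, α₀ < βseq n := fun n => by
    have : 0 < (s / 4 - α₀) / ((n : ℝ) + 1) := by positivity
    simp only [hβseq]; linarith
  have hβanti : Antitone βseq := fun m n hmn => by
    simp only [hβseq]
    have h1 : (s / 4 - α₀) / ((n : ℝ) + 1) ≤ (s / 4 - α₀) / ((m : ℝ) + 1) :=
      div_le_div_of_nonneg_left hgap.le (by positivity) (by exact_mod_cast Nat.add_le_add_right hmn 1)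
    linarith
  have hβlim : Tendsto βseq atTop (𝓝 α₀) := by
    have h1 : Tendsto (fun n : ℕ => (s / 4 - α₀) / ((n : ℝ) + 1)) atTop (𝓝 0) :=
      tendsto_const_nhds.div_atTop (tendsto_natCast_atTop_atTop.atTop_add tendsto_const_nhds)
    simpa [hβseq] using (tendsto_const_nhds (x := α₀)).add h1
  set Ev : ℕ → Set Ω₂ := fun n => hEv s 0 (βseq n) with hEvdef
  have hanti : Antitone Ev := fun m n hmn => hEv_mono le_rfl (hβanti hmn)
  have hlim := tendsto_measure_iInter_atTop (μ := μ) (fun n => (measurableSet_hEv s 0 (βseq n)).nullMeasurableSet)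
    hanti ⟨0, measure_ne_top _ _⟩
  have hge : ∀ n, ENNReal.ofReal (3 / 16) ≤ μ (Ev n) := fun n => by
    have h := hstrict (βseq n) (hβgt n)
    rw [measureReal_def] at h
    exact (ENNReal.ofReal_le_iff_le_toReal (measure_ne_top _ _)).2 h
  have hinter : ENNReal.ofReal (3 / 16) ≤ μ (⋂ n, Ev n) := ge_of_tendsto' hlim fun n => hge n
  have hsub : (⋂ n, Ev n) ⊆ hEv s 0 α₀ := iInter_hEv_zero_subset_of_tendsto hα₀0 hβlim
  rw [← heq, measureReal_def]
  exact (ENNReal.ofReal_le_iff_le_toReal (measure_ne_top _ _)).1 (hinter.trans (measure_mono hsub))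

end AlphaS

/-! ### Transport of continua along `pairImage` -/

section TransportContinuum

/-- A black continuum of the moved configuration pulls back to a black continuum of the original
configuration, meeting the preimages of whatever the former met. [folklore] -/
theorem exists_continuum_preimage {e : ℂ ≃ₜ ℂ} (he : Isometry e) {ω : Ω₂} {C R : Set ℂ}
    (hC : C ⊆ blackRegion (((pairImage e ω).1 : PointConfig ℂ) : Set ℂ)
      (((pairImage e ω).2 : PointConfig ℂ) : Set ℂ) ∩ R)
    (hCc : IsCompact C) (hCp : IsPreconnected C) :
    e ⁻¹' C ⊆ blackRegion ((ω.1 : PointConfig ℂ) : Set ℂ) ((ω.2 : PointConfig ℂ) : Set ℂ) ∩ e ⁻¹' R ∧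
      IsCompact (e ⁻¹' C) ∧ IsPreconnected (e ⁻¹' C) ∧
      ∀ A : Set ℂ, (C ∩ A).Nonempty → (e ⁻¹' C ∩ e ⁻¹' A).Nonempty := by
  simp only [coe_pairImage_fst, coe_pairImage_snd] at hC
  refine ⟨fun w hw => ⟨(mem_blackRegion_image_iff he _ _ w).1 (hC hw).1, (hC hw).2⟩, ?_, ?_, ?_⟩
  · rw [← e.image_symm]; exact hCc.image e.symm.continuous
  · rw [← e.image_symm]; exact hCp.image _ e.symm.continuous.continuousOn
  · rintro A ⟨x, hxC, hxA⟩
    exact ⟨e.symm x, by simpa only [mem_preimage, Homeomorph.apply_symm_apply] using hxC,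
      by simpa only [mem_preimage, Homeomorph.apply_symm_apply] using hxA⟩

/-- Good-increasing events pull back to good-increasing events along `pairImage`. [folklore] -/
theorem IsGoodIncreasing.preimage_pairImage {E : Set Ω₂} (hE : IsGoodIncreasing E) (e : ℂ ≃ₜ ℂ) :
    IsGoodIncreasing (pairImage e ⁻¹' E) := by
  intro ω ω' hω hB hW' h1 h2
  refine hE hω ?_ ?_ ?_ ?_
  · simpa only [coe_pairImage_fst, image_nonempty] using hB
  · simpa only [coe_pairImage_snd, image_nonempty] using hW'
  · simpa only [coe_pairImage_fst] using image_mono h1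
  · simpa only [coe_pairImage_snd] using image_mono h2

/-- Preimages of measurable events along `pairImage` are measurable. [folklore] -/
theorem measurableSet_preimage_pairImage {E : Set Ω₂} (hE : MeasurableSet E) (e : ℂ ≃ₜ ℂ) :
    MeasurableSet (pairImage e ⁻¹' E) := by
  rw [← coe_pairImageEquiv]; exact (pairImageEquiv e).measurable hE

end TransportContinuum

/-! ### The four-legged event `X_s(α)` (Lemma 2.1) -/

section XEvent

variable {s α : ℝ} {PB PW : Measure (PointConfig ℂ)}

/-- **`X_s(α)` as an intersection**: the four symmetric copies of `H_s(α, s/2)` (left side to the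
upper-right / lower-right corner segment, right side to the upper-left / lower-left corner segment)
and a top–bottom crossing of `B_{s/2}`. [cite: Tassion2016, proof of Lemma 2.1] -/
def xEv (s α : ℝ) : Set Ω₂ :=
  hEv s α (s / 2) ∩ hEv s (-(s / 2)) (-α) ∩
  blackCross (sqr s) {z | z.re = s / 2} (lseg s α (s / 2)) ∩
  blackCross (sqr s) {z | z.re = s / 2} (lseg s (-(s / 2)) (-α)) ∩
  tbCross (-(s / 2)) (s / 2) (-(s / 2)) (s / 2)

/-- `X_s(α)` is measurable. [folklore] -/
theorem measurableSet_xEv (s α : ℝ) : MeasurableSet (xEv s α) :=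
  ((((measurableSet_hEv _ _ _).inter (measurableSet_hEv _ _ _)).inter
    (measurableSet_blackCross (isCompact_sqr s) (isClosed_setOf_re_eq _) (isClosed_lseg _ _ _))).inter
    (measurableSet_blackCross (isCompact_sqr s) (isClosed_setOf_re_eq _) (isClosed_lseg _ _ _))).inter
    (measurableSet_tbCross _ _ _ _)

/-- `X_s(α)` is good-increasing. [cite: Tassion2016, §1.2] -/
theorem isGoodIncreasing_xEv (s α : ℝ) : IsGoodIncreasing (xEv s α) :=
  ((((isGoodIncreasing_hEv _ _ _).inter (isGoodIncreasing_hEv _ _ _)).inter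
    (isGoodIncreasing_blackCross _ _ _)).inter (isGoodIncreasing_blackCross _ _ _)).inter
    (isGoodIncreasing_blackCross _ _ _)

/-- The reflection `z ↦ -conj z` in the imaginary axis as a real-linear isometry. [folklore] -/
def negConjLIE : ℂ ≃ₗᵢ[ℝ] ℂ := conjLIE.trans (LinearIsometryEquiv.neg ℝ)

/-- The reflection in the imaginary axis. [folklore] -/
@[simp] theorem negConjLIE_apply (z : ℂ) : negConjLIE z = -(starRingEnd ℂ) z := rfl

/-- The reflection in the imaginary axis maps the square to itself. [folklore] -/
theorem preimage_negConjLIE_sqr (s : ℝ) : negConjLIE ⁻¹' sqr s = sqr s := by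
  ext z
  simp only [mem_preimage, mem_sqr, negConjLIE_apply, neg_re, neg_im, conj_re, conj_im, neg_neg]
  constructor <;> rintro ⟨⟨h1, h2⟩, h3⟩ <;> exact ⟨⟨by linarith, by linarith⟩, h3⟩

/-- The reflection in the imaginary axis exchanges the vertical sides. [folklore] -/
theorem preimage_negConjLIE_setOf_re_eq (a : ℝ) :
    negConjLIE ⁻¹' {z : ℂ | z.re = a} = {z : ℂ | z.re = -a} := by
  ext z
  simp only [mem_preimage, mem_setOf_eq, negConjLIE_apply, neg_re, conj_re]
  constructor <;> intro h <;> linarith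

/-- The reflection in the imaginary axis maps right segments to left segments. [folklore] -/
theorem preimage_negConjLIE_rseg (s α β : ℝ) : negConjLIE ⁻¹' rseg s α β = lseg s α β := by
  ext z
  simp only [mem_preimage, rseg, lseg, mem_setOf_eq, negConjLIE_apply, neg_re, neg_im, conj_re,
    conj_im, neg_neg]
  constructor <;> rintro ⟨h1, h2, h3⟩ <;> exact ⟨by linarith, h2, h3⟩

/-- The point reflection `z ↦ -z` maps the square to itself. [folklore] -/
theorem preimage_neg_sqr (s : ℝ) : (LinearIsometryEquiv.neg ℝ : ℂ ≃ₗᵢ[ℝ] ℂ) ⁻¹' sqr s = sqr s := by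
  ext z
  simp only [mem_preimage, LinearIsometryEquiv.coe_neg, mem_sqr, neg_re, neg_im]
  constructor <;> rintro ⟨⟨h1, h2⟩, h3, h4⟩ <;> exact ⟨⟨by linarith, by linarith⟩, by linarith, by linarith⟩

/-- The point reflection exchanges the vertical sides. [folklore] -/
theorem preimage_neg_setOf_re_eq (a : ℝ) :
    (LinearIsometryEquiv.neg ℝ : ℂ ≃ₗᵢ[ℝ] ℂ) ⁻¹' {z : ℂ | z.re = a} = {z : ℂ | z.re = -a} := by
  ext z
  simp only [mem_preimage, LinearIsometryEquiv.coe_neg, mem_setOf_eq, neg_re]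
  constructor <;> intro h <;> linarith

/-- The point reflection maps the upper-right segment to the lower-left one. [folklore] -/
theorem preimage_neg_rseg (s α β : ℝ) :
    (LinearIsometryEquiv.neg ℝ : ℂ ≃ₗᵢ[ℝ] ℂ) ⁻¹' rseg s α β = lseg s (-β) (-α) := by
  ext z
  simp only [mem_preimage, LinearIsometryEquiv.coe_neg, rseg, lseg, mem_setOf_eq, neg_re, neg_im]
  constructor <;> rintro ⟨h1, h2, h3⟩ <;> exact ⟨by linarith, by linarith, by linarith⟩

/-- The three reflected copies of `H_s(α, s/2)` have its probability. [cite: Tassion2016, Remark 2] -/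
theorem measure_xEv_pieces (hB : IsPoissonPointProcess (volume : Measure ℂ) PB)
    (hW : IsPoissonPointProcess (volume : Measure ℂ) PW) (s α : ℝ) :
    (PB.prod PW) (hEv s (-(s / 2)) (-α)) = (PB.prod PW) (hEv s α (s / 2)) ∧
    (PB.prod PW) (blackCross (sqr s) {z | z.re = s / 2} (lseg s α (s / 2))) =
      (PB.prod PW) (hEv s α (s / 2)) ∧
    (PB.prod PW) (blackCross (sqr s) {z | z.re = s / 2} (lseg s (-(s / 2)) (-α))) =
      (PB.prod PW) (hEv s α (s / 2)) := by
  refine ⟨?_, ?_, ?_⟩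
  · have h := measure_blackCross_preimage_linearIsometryEquiv hB hW conjLIE (sqr s)
      {z | z.re = -(s / 2)} (rseg s α (s / 2))
    rwa [preimage_conjLIE_sqr, preimage_conjLIE_setOf_re_eq, preimage_conjLIE_rseg] at h
  · have h := measure_blackCross_preimage_linearIsometryEquiv hB hW negConjLIE (sqr s)
      {z | z.re = -(s / 2)} (rseg s α (s / 2))
    rwa [preimage_negConjLIE_sqr, preimage_negConjLIE_setOf_re_eq, preimage_negConjLIE_rseg,
      neg_neg] at h
  · have h := measure_blackCross_preimage_linearIsometryEquiv hB hW (LinearIsometryEquiv.neg ℝ) (sqr s)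
      {z | z.re = -(s / 2)} (rseg s α (s / 2))
    rwa [preimage_neg_sqr, preimage_neg_setOf_re_eq, preimage_neg_rseg, neg_neg] at h

/-- **Lemma 2.1 (P1), probability of `X_s(α)`**: `P[X_s(α)] ≥ ψ_s(α)⁴ / 2` (FKG, symmetry and the
square crossing bound), hence `≥ c₁ = (1/16)⁴/2` for `α ≤ α_s`. [cite: Tassion2016, Lemma 2.1 (P1)] -/
theorem measureReal_xEv_ge_pow (hB : IsPoissonPointProcess (volume : Measure ℂ) PB)
    (hW : IsPoissonPointProcess (volume : Measure ℂ) PW) (hs : 0 < s) (α : ℝ) :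
    psiF (PB.prod PW) s α ^ 4 * (1 / 2) ≤ (PB.prod PW).real (xEv s α) := by
  haveI := hB.isProbabilityMeasure; haveI := hW.isProbabilityMeasure
  set μ := PB.prod PW with hμ
  obtain ⟨e1, e2, e3⟩ := measure_xEv_pieces hB hW s α
  have h1 : μ.real (hEv s (-(s / 2)) (-α)) = psiF μ s α := by rw [psiF, measureReal_def, measureReal_def, e1]
  have h2 : μ.real (blackCross (sqr s) {z | z.re = s / 2} (lseg s α (s / 2))) = psiF μ s α := by
    rw [psiF, measureReal_def, measureReal_def, e2]
  have h3 : μ.real (blackCross (sqr s) {z | z.re = s / 2} (lseg s (-(s / 2)) (-α))) = psiF μ s α := by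
    rw [psiF, measureReal_def, measureReal_def, e3]
  have h5 : 1 / 2 ≤ μ.real (tbCross (-(s / 2)) (s / 2) (-(s / 2)) (s / 2)) := by
    rw [measureReal_def, measure_tbCross_eq hB hW, ← measureReal_def]
    exact half_le_measureReal_lrCross_square hB hW (by linarith) rfl
  have hp : 0 ≤ psiF μ s α := measureReal_nonneg
  -- FKG, four times
  have m1 := measurableSet_hEv s α (s / 2)
  have m2 := measurableSet_hEv s (-(s / 2)) (-α)
  have m3 : MeasurableSet (blackCross (sqr s) {z | z.re = s / 2} (lseg s α (s / 2))) :=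
    measurableSet_blackCross (isCompact_sqr s) (isClosed_setOf_re_eq _) (isClosed_lseg _ _ _)
  have m4 : MeasurableSet (blackCross (sqr s) {z | z.re = s / 2} (lseg s (-(s / 2)) (-α))) :=
    measurableSet_blackCross (isCompact_sqr s) (isClosed_setOf_re_eq _) (isClosed_lseg _ _ _)
  have m5 := measurableSet_tbCross (-(s / 2)) (s / 2) (-(s / 2)) (s / 2)
  have g1 := isGoodIncreasing_hEv s α (s / 2)
  have g2 := isGoodIncreasing_hEv s (-(s / 2)) (-α)
  have g3 := isGoodIncreasing_blackCross (sqr s) {z | z.re = s / 2} (lseg s α (s / 2))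
  have g4 := isGoodIncreasing_blackCross (sqr s) {z | z.re = s / 2} (lseg s (-(s / 2)) (-α))
  have g5 := isGoodIncreasing_blackCross (cRect (-(s / 2)) (s / 2) (-(s / 2)) (s / 2))
    {z | z.im = -(s / 2)} {z | z.im = s / 2}
  have f12 := measureReal_mul_le_of_isGoodIncreasing hB hW g1 g2 m1 m2
  have f123 := measureReal_mul_le_of_isGoodIncreasing hB hW (g1.inter g2) g3 (m1.inter m2) m3
  have f1234 := measureReal_mul_le_of_isGoodIncreasing hB hW ((g1.inter g2).inter g3) g4
    ((m1.inter m2).inter m3) m4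
  have f12345 := measureReal_mul_le_of_isGoodIncreasing hB hW (((g1.inter g2).inter g3).inter g4) g5
    (((m1.inter m2).inter m3).inter m4) m5
  rw [h1] at f12
  rw [h2] at f123
  rw [h3] at f1234
  have hq : 0 ≤ μ.real (tbCross (-(s / 2)) (s / 2) (-(s / 2)) (s / 2)) := measureReal_nonneg
  have e1' : psiF μ s α ^ 2 ≤ μ.real (hEv s α (s / 2) ∩ hEv s (-(s / 2)) (-α)) := by
    rw [psiF] at f12 ⊢; nlinarith
  have e2' : psiF μ s α ^ 3 ≤ μ.real (hEv s α (s / 2) ∩ hEv s (-(s / 2)) (-α) ∩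
      blackCross (sqr s) {z | z.re = s / 2} (lseg s α (s / 2))) := by
    nlinarith [mul_le_mul e1' le_rfl hp measureReal_nonneg]
  have e3' : psiF μ s α ^ 4 ≤ μ.real (hEv s α (s / 2) ∩ hEv s (-(s / 2)) (-α) ∩
      blackCross (sqr s) {z | z.re = s / 2} (lseg s α (s / 2)) ∩
      blackCross (sqr s) {z | z.re = s / 2} (lseg s (-(s / 2)) (-α))) := by
    nlinarith [mul_le_mul e2' le_rfl hp measureReal_nonneg]
  calc psiF μ s α ^ 4 * (1 / 2) ≤ _ * μ.real (tbCross (-(s / 2)) (s / 2) (-(s / 2)) (s / 2)) :=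
        mul_le_mul e3' h5 (by norm_num) measureReal_nonneg
    _ ≤ μ.real (xEv s α) := f12345

/-- **Lemma 2.1 (P1)**: `P[X_s(α)] ≥ c₁ = (1/16)⁴/2` for `α ≤ α_s`. [cite: Tassion2016, Lemma 2.1 (P1)] -/
theorem measureReal_xEv_ge (hB : IsPoissonPointProcess (volume : Measure ℂ) PB)
    (hW : IsPoissonPointProcess (volume : Measure ℂ) PW) (hs : 0 < s) (hα : α ≤ alphaS (PB.prod PW) s) :
    (1 / 16) ^ 4 * (1 / 2) ≤ (PB.prod PW).real (xEv s α) := by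
  have h := psiF_ge_of_le_alphaS hB hW hs hα
  refine le_trans ?_ (measureReal_xEv_ge_pow hB hW hs α)
  exact mul_le_mul_of_nonneg_right (pow_le_pow_left₀ (by norm_num) h 4) (by norm_num)

/-- **The four legs**: on `X_s(α)` one weak-black continuum in `B_{s/2}` touches the four corner
segments `{±s/2} × [α, s/2]`, `{±s/2} × [-s/2, -α]` (each copy of `H_s` crosses the square
horizontally and so meets the top–bottom crossing). [cite: Tassion2016, §2 (definition of X_s(α))] -/
theorem exists_fourLegs_of_mem_xEv {ω : Ω₂} (hs : 0 < s) (hω : ω ∈ xEv s α) :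
    ∃ C ⊆ blackRegion ((ω.1 : PointConfig ℂ) : Set ℂ) ((ω.2 : PointConfig ℂ) : Set ℂ) ∩ sqr s,
      IsCompact C ∧ IsPreconnected C ∧ (C ∩ rseg s α (s / 2)).Nonempty ∧
      (C ∩ rseg s (-(s / 2)) (-α)).Nonempty ∧ (C ∩ lseg s α (s / 2)).Nonempty ∧
      (C ∩ lseg s (-(s / 2)) (-α)).Nonempty := by
  obtain ⟨⟨⟨⟨h1, h2⟩, h3⟩, h4⟩, h5⟩ := hω
  obtain ⟨C₅, hC₅, hC₅c, hC₅p, ⟨b₅, hb₅, hb₅im⟩, ⟨t₅, ht₅, ht₅im⟩⟩ := h5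
  have hss : -(s / 2) ≤ s / 2 := by linarith
  -- each `H`-continuum crosses the square horizontally, hence meets `C₅`
  have meet : ∀ {C : Set ℂ}, C ⊆ blackRegion ((ω.1 : PointConfig ℂ) : Set ℂ)
      ((ω.2 : PointConfig ℂ) : Set ℂ) ∩ sqr s → IsCompact C → IsPreconnected C →
      (∃ z ∈ C, z.re = -(s / 2)) → (∃ z ∈ C, z.re = s / 2) → (C ∩ C₅).Nonempty := by
    intro C hC hCc hCp ha hb
    exact inter_nonempty_of_crossing_continua hss hss hCc hCp (fun w hw => (hC hw).2) ha hb hC₅c hC₅p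
      (fun w hw => (hC₅ hw).2) ⟨b₅, hb₅, hb₅im⟩ ⟨t₅, ht₅, ht₅im⟩
  obtain ⟨C₁, hC₁, hC₁c, hC₁p, ⟨a₁, ha₁, ha₁re⟩, ⟨y₁, hy₁, hy₁s⟩⟩ := h1
  obtain ⟨C₂, hC₂, hC₂c, hC₂p, ⟨a₂, ha₂, ha₂re⟩, ⟨y₂, hy₂, hy₂s⟩⟩ := h2
  obtain ⟨C₃, hC₃, hC₃c, hC₃p, ⟨a₃, ha₃, ha₃re⟩, ⟨y₃, hy₃, hy₃s⟩⟩ := h3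
  obtain ⟨C₄, hC₄, hC₄c, hC₄p, ⟨a₄, ha₄, ha₄re⟩, ⟨y₄, hy₄, hy₄s⟩⟩ := h4
  obtain ⟨w₁, hw₁C, hw₁5⟩ := meet hC₁ hC₁c hC₁p ⟨a₁, ha₁, ha₁re⟩ ⟨y₁, hy₁, hy₁s.1⟩
  obtain ⟨w₂, hw₂C, hw₂5⟩ := meet hC₂ hC₂c hC₂p ⟨a₂, ha₂, ha₂re⟩ ⟨y₂, hy₂, hy₂s.1⟩
  obtain ⟨w₃, hw₃C, hw₃5⟩ := meet hC₃ hC₃c hC₃p ⟨y₃, hy₃, hy₃s.1⟩ ⟨a₃, ha₃, ha₃re⟩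
  obtain ⟨w₄, hw₄C, hw₄5⟩ := meet hC₄ hC₄c hC₄p ⟨y₄, hy₄, hy₄s.1⟩ ⟨a₄, ha₄, ha₄re⟩
  refine ⟨(((C₅ ∪ C₁) ∪ C₂) ∪ C₃) ∪ C₄, ?_, ?_, ?_, ⟨y₁, by simp [hy₁], hy₁s⟩,
    ⟨y₂, by simp [hy₂], hy₂s⟩, ⟨y₃, by simp [hy₃], hy₃s⟩, ⟨y₄, by simp [hy₄], hy₄s⟩⟩
  · exact union_subset (union_subset (union_subset (union_subset hC₅ hC₁) hC₂) hC₃) hC₄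
  · exact (((hC₅c.union hC₁c).union hC₂c).union hC₃c).union hC₄c
  · refine IsPreconnected.union w₄ (by simp [hw₄5]) hw₄C ?_ hC₄p
    refine IsPreconnected.union w₃ (by simp [hw₃5]) hw₃C ?_ hC₃p
    refine IsPreconnected.union w₂ (by simp [hw₂5]) hw₂C ?_ hC₂p
    exact IsPreconnected.union w₁ hw₁5 hw₁C hC₅p hC₁p

end XEvent

/-! ### Chaining crossings (Cor. 1.3 (2)) -/

section Chain

variable {PB PW : Measure (PointConfig ℂ)}

/-- **One chaining step**: left–right crossings of `[x₀, x₂] × [c, d]` and `[x₁, x₃] × [c, d]`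
and a top–bottom crossing of the overlap `[x₁, x₂] × [c, d]` give a left–right crossing of
`[x₀, x₃] × [c, d]` (plus-position crossing lemma, twice). [cite: Tassion2016, Cor 1.3 (2)] -/
theorem lrCross_chain_step {x₀ x₁ x₂ x₃ c d : ℝ} (h01 : x₀ ≤ x₁) (h12 : x₁ ≤ x₂) (h23 : x₂ ≤ x₃)
    (hcd : c ≤ d) :
    lrCross x₀ x₂ c d ∩ tbCross x₁ x₂ c d ∩ lrCross x₁ x₃ c d ⊆ lrCross x₀ x₃ c d := by
  rintro ω ⟨⟨⟨K₁, hK₁, hK₁c, hK₁p, ⟨a₁, ha₁, ha₁re⟩, ⟨b₁, hb₁, hb₁re⟩⟩,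
    ⟨V, hV, hVc, hVp, ⟨p, hp, hpim⟩, ⟨q, hq, hqim⟩⟩⟩, ⟨K₂, hK₂, hK₂c, hK₂p, ⟨a₂, ha₂, ha₂re⟩, ⟨b₂, hb₂, hb₂re⟩⟩⟩
  have hVK₁ : (V ∩ K₁).Nonempty :=
    inter_nonempty_of_plus h12 hcd hVc hVp (fun w hw => (mem_cRect.1 (hV hw).2).1) ⟨p, hp, hpim.le⟩
      ⟨q, hq, hqim.ge⟩ hK₁c hK₁p (fun w hw => (mem_cRect.1 (hK₁ hw).2).2)
      ⟨a₁, ha₁, by rw [ha₁re]; exact h01⟩ ⟨b₁, hb₁, hb₁re.ge⟩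
  have hVK₂ : (V ∩ K₂).Nonempty :=
    inter_nonempty_of_plus h12 hcd hVc hVp (fun w hw => (mem_cRect.1 (hV hw).2).1) ⟨p, hp, hpim.le⟩
      ⟨q, hq, hqim.ge⟩ hK₂c hK₂p (fun w hw => (mem_cRect.1 (hK₂ hw).2).2)
      ⟨a₂, ha₂, ha₂re.le⟩ ⟨b₂, hb₂, by rw [hb₂re]; exact h23⟩
  obtain ⟨w₁, hw₁V, hw₁K⟩ := hVK₁
  obtain ⟨w₂, hw₂V, hw₂K⟩ := hVK₂
  refine ⟨(V ∪ K₁) ∪ K₂, ?_, (hVc.union hK₁c).union hK₂c, ?_, ⟨a₁, Or.inl (Or.inr ha₁), ha₁re⟩,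
    ⟨b₂, Or.inr hb₂, hb₂re⟩⟩
  · refine union_subset (union_subset ?_ ?_) ?_
    · exact fun w hw => ⟨(hV hw).1, by
        have h := mem_cRect.1 (hV hw).2
        exact mem_cRect.2 ⟨⟨h01.trans h.1.1, h.1.2.trans h23⟩, h.2⟩⟩
    · exact fun w hw => ⟨(hK₁ hw).1, by
        have h := mem_cRect.1 (hK₁ hw).2
        exact mem_cRect.2 ⟨⟨h.1.1, h.1.2.trans h23⟩, h.2⟩⟩
    · exact fun w hw => ⟨(hK₂ hw).1, by
        have h := mem_cRect.1 (hK₂ hw).2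
        exact mem_cRect.2 ⟨⟨h01.trans h.1.1, h.1.2⟩, h.2⟩⟩
  · exact (hVp.union w₁ hw₁V hw₁K hK₁p).union w₂ (Or.inl hw₂V) hw₂K hK₂p

/-- **Cor. 1.3 (2): `f_s(1 + iκ) ≥ f_s(1 + κ)^i f_s(1)^{i-1}`** (chaining step, FKG, translation
and transposition invariance), for `i ≥ 1`. [cite: Tassion2016, Cor 1.3 (2)] -/
theorem measureReal_lrCross_chain (hB : IsPoissonPointProcess (volume : Measure ℂ) PB)
    (hW : IsPoissonPointProcess (volume : Measure ℂ) PW) {s κ : ℝ} (hs : 0 < s) (hκ : 0 < κ) (i : ℕ) :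
    (PB.prod PW).real (lrCross 0 ((1 + κ) * s) 0 s) ^ (i + 1) * (PB.prod PW).real (lrCross 0 s 0 s) ^ i ≤
      (PB.prod PW).real (lrCross 0 ((1 + (i + 1 : ℕ) * κ) * s) 0 s) := by
  haveI := hB.isProbabilityMeasure; haveI := hW.isProbabilityMeasure
  set μ := PB.prod PW with hμ
  induction i with
  | zero => simp
  | succ i ih =>
    -- glue a crossing of `[x₁, x₃] × [0, s]` to the crossing of `[0, x₂] × [0, s]`
    set x₁ : ℝ := (i + 1 : ℕ) * κ * s with hx₁
    set x₂ : ℝ := (1 + (i + 1 : ℕ) * κ) * s with hx₂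
    set x₃ : ℝ := (1 + (i + 1 + 1 : ℕ) * κ) * s with hx₃
    have hik : (0 : ℝ) ≤ (i + 1 : ℕ) * κ := by positivity
    have h01 : (0 : ℝ) ≤ x₁ := by positivity
    have h12 : x₁ ≤ x₂ := by rw [hx₁, hx₂]; nlinarith
    have h23 : x₂ ≤ x₃ := by rw [hx₂, hx₃]; push_cast; nlinarith
    have hstep := lrCross_chain_step h01 h12 h23 hs.le (c := 0) (d := s)
    have mA := measurableSet_lrCross 0 x₂ 0 s
    have mV := measurableSet_tbCross x₁ x₂ 0 s
    have mK := measurableSet_lrCross x₁ x₃ 0 s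
    have gA : IsGoodIncreasing (lrCross 0 x₂ 0 s) := isGoodIncreasing_blackCross _ _ _
    have gV : IsGoodIncreasing (tbCross x₁ x₂ 0 s) := isGoodIncreasing_blackCross _ _ _
    have gK : IsGoodIncreasing (lrCross x₁ x₃ 0 s) := isGoodIncreasing_blackCross _ _ _
    have f1 := measureReal_mul_le_of_isGoodIncreasing hB hW gA gV mA mV
    have f2 := measureReal_mul_le_of_isGoodIncreasing hB hW (gA.inter gV) gK (mA.inter mV) mK
    have hVeq : μ.real (tbCross x₁ x₂ 0 s) = μ.real (lrCross 0 s 0 s) := by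
      rw [measureReal_def, measureReal_def, measure_tbCross_eq hB hW]
      exact congrArg ENNReal.toReal (measure_lrCross_eq_of_shape hB hW (by ring)
        (by rw [hx₁, hx₂]; ring))
    have hKeq : μ.real (lrCross x₁ x₃ 0 s) = μ.real (lrCross 0 ((1 + κ) * s) 0 s) := by
      rw [measureReal_def, measureReal_def]
      exact congrArg ENNReal.toReal (measure_lrCross_eq_of_shape hB hW
        (by rw [hx₁, hx₃]; push_cast; ring) (by ring))
    rw [hVeq] at f1
    rw [hKeq] at f2
    have hmono : μ.real (lrCross 0 x₂ 0 s ∩ tbCross x₁ x₂ 0 s ∩ lrCross x₁ x₃ 0 s) ≤ μ.real (lrCross 0 x₃ 0 s) :=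
      measureReal_mono hstep (measure_ne_top _ _)
    have hF : 0 ≤ μ.real (lrCross 0 ((1 + κ) * s) 0 s) := measureReal_nonneg
    have hG : 0 ≤ μ.real (lrCross 0 s 0 s) := measureReal_nonneg
    calc μ.real (lrCross 0 ((1 + κ) * s) 0 s) ^ (i + 1 + 1) * μ.real (lrCross 0 s 0 s) ^ (i + 1)
        = (μ.real (lrCross 0 ((1 + κ) * s) 0 s) ^ (i + 1) * μ.real (lrCross 0 s 0 s) ^ i) *
            μ.real (lrCross 0 s 0 s) * μ.real (lrCross 0 ((1 + κ) * s) 0 s) := by ring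
      _ ≤ μ.real (lrCross 0 x₂ 0 s) * μ.real (lrCross 0 s 0 s) * μ.real (lrCross 0 ((1 + κ) * s) 0 s) := by
            gcongr
      _ ≤ μ.real (lrCross 0 x₂ 0 s ∩ tbCross x₁ x₂ 0 s) * μ.real (lrCross 0 ((1 + κ) * s) 0 s) := by
            gcongr
      _ ≤ _ := f2
      _ ≤ _ := hmono

/-- **Restriction**: a left–right crossing of a longer rectangle `[0, X] × [c, d]`, `X ≥ L`, contains
one of `[0, L] × [c, d]` (sub-continuum between the lines `re = 0`, `re = L`).
[cite: Tassion2016, §1.1] -/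
theorem lrCross_subset_of_le {L X c d : ℝ} (hL : 0 ≤ L) (hLX : L ≤ X) :
    lrCross 0 X c d ⊆ lrCross 0 L c d := by
  rintro ω ⟨K, hK, hKc, hKp, ⟨a, ha, hare⟩, ⟨b, hb, hbre⟩⟩
  obtain ⟨K', hK'K, hK'c, hK'p, hK'strip, hK'a, hK'b⟩ := exists_subcontinuum_between_lines hL hKc hKp
    ⟨a, ha, hare.le⟩ ⟨b, hb, by rw [hbre]; exact hLX⟩
  refine ⟨K', fun w hw => ⟨(hK (hK'K hw)).1, ?_⟩, hK'c, hK'p, hK'a, hK'b⟩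
  have h := mem_cRect.1 (hK (hK'K hw)).2
  exact mem_cRect.2 ⟨hK'strip w hw, h.2⟩

/-- A left–right crossing of a sub-band `[a, b] × [c', d'] ⊆ [a, b] × [c, d]` is a left–right
crossing of the bigger rectangle. [folklore] -/
theorem lrCross_subset_of_band {a b c d c' d' : ℝ} (hc : c ≤ c') (hd : d' ≤ d) :
    lrCross a b c' d' ⊆ lrCross a b c d :=
  blackCross_mono (fun _ hz => by
    have h := mem_cRect.1 hz
    exact mem_cRect.2 ⟨h.1, hc.trans h.2.1, h.2.2.trans hd⟩) Subset.rfl Subset.rfl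

end Chain

/-! ### The annulus event `A_s` and its hooks (Cor. 1.3 (3)) -/

section Annulus

variable {PB PW : Measure (PointConfig ℂ)} {s : ℝ}

/-- **The annulus event** (replacing Tassion's circuit event `A_s`): weak-black long crossings of
the four rectangles of `[-2s, 2s]² ∖ (-s, s)²` — top and bottom left–right, left and right
top–bottom. [cite: Tassion2016, §1.1 (A_s) and Cor 1.3 (3)] -/
def annEv (s : ℝ) : Set Ω₂ :=
  lrCross (-(2 * s)) (2 * s) s (2 * s) ∩ lrCross (-(2 * s)) (2 * s) (-(2 * s)) (-s) ∩
  tbCross (-(2 * s)) (-s) (-(2 * s)) (2 * s) ∩ tbCross s (2 * s) (-(2 * s)) (2 * s)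

/-- The annulus event is measurable. [folklore] -/
theorem measurableSet_annEv (s : ℝ) : MeasurableSet (annEv s) :=
  (((measurableSet_lrCross _ _ _ _).inter (measurableSet_lrCross _ _ _ _)).inter
    (measurableSet_tbCross _ _ _ _)).inter (measurableSet_tbCross _ _ _ _)

/-- The annulus event is good-increasing. [cite: Tassion2016, §1.2] -/
theorem isGoodIncreasing_annEv (s : ℝ) : IsGoodIncreasing (annEv s) :=
  (((isGoodIncreasing_blackCross _ _ _).inter (isGoodIncreasing_blackCross _ _ _)).inter
    (isGoodIncreasing_blackCross _ _ _)).inter (isGoodIncreasing_blackCross _ _ _)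

/-- **Cor. 1.3 (3): `P[A_s] ≥ f_s(4)⁴`.** [cite: Tassion2016, Cor 1.3 (3)] -/
theorem measureReal_annEv_ge (hB : IsPoissonPointProcess (volume : Measure ℂ) PB)
    (hW : IsPoissonPointProcess (volume : Measure ℂ) PW) :
    (PB.prod PW).real (lrCross 0 (4 * s) 0 s) ^ 4 ≤ (PB.prod PW).real (annEv s) := by
  haveI := hB.isProbabilityMeasure; haveI := hW.isProbabilityMeasure
  set μ := PB.prod PW with hμ
  set f := μ.real (lrCross 0 (4 * s) 0 s) with hf
  have hf0 : 0 ≤ f := measureReal_nonneg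
  have e1 : μ.real (lrCross (-(2 * s)) (2 * s) s (2 * s)) = f := by
    rw [hf, measureReal_def, measureReal_def]
    exact congrArg ENNReal.toReal (measure_lrCross_eq_of_shape hB hW (by ring) (by ring))
  have e2 : μ.real (lrCross (-(2 * s)) (2 * s) (-(2 * s)) (-s)) = f := by
    rw [hf, measureReal_def, measureReal_def]
    exact congrArg ENNReal.toReal (measure_lrCross_eq_of_shape hB hW (by ring) (by ring))
  have e3 : μ.real (tbCross (-(2 * s)) (-s) (-(2 * s)) (2 * s)) = f := by
    rw [hf, measureReal_def, measureReal_def, measure_tbCross_eq hB hW]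
    exact congrArg ENNReal.toReal (measure_lrCross_eq_of_shape hB hW (by ring) (by ring))
  have e4 : μ.real (tbCross s (2 * s) (-(2 * s)) (2 * s)) = f := by
    rw [hf, measureReal_def, measureReal_def, measure_tbCross_eq hB hW]
    exact congrArg ENNReal.toReal (measure_lrCross_eq_of_shape hB hW (by ring) (by ring))
  have m1 := measurableSet_lrCross (-(2 * s)) (2 * s) s (2 * s)
  have m2 := measurableSet_lrCross (-(2 * s)) (2 * s) (-(2 * s)) (-s)
  have m3 := measurableSet_tbCross (-(2 * s)) (-s) (-(2 * s)) (2 * s)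
  have m4 := measurableSet_tbCross s (2 * s) (-(2 * s)) (2 * s)
  have g1 : IsGoodIncreasing (lrCross (-(2 * s)) (2 * s) s (2 * s)) := isGoodIncreasing_blackCross _ _ _
  have g2 : IsGoodIncreasing (lrCross (-(2 * s)) (2 * s) (-(2 * s)) (-s)) := isGoodIncreasing_blackCross _ _ _
  have g3 : IsGoodIncreasing (tbCross (-(2 * s)) (-s) (-(2 * s)) (2 * s)) := isGoodIncreasing_blackCross _ _ _
  have g4 : IsGoodIncreasing (tbCross s (2 * s) (-(2 * s)) (2 * s)) := isGoodIncreasing_blackCross _ _ _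
  have f12 := measureReal_mul_le_of_isGoodIncreasing hB hW g1 g2 m1 m2
  have f123 := measureReal_mul_le_of_isGoodIncreasing hB hW (g1.inter g2) g3 (m1.inter m2) m3
  have f1234 := measureReal_mul_le_of_isGoodIncreasing hB hW ((g1.inter g2).inter g3) g4
    ((m1.inter m2).inter m3) m4
  rw [e1, e2] at f12
  rw [e3] at f123
  rw [e4] at f1234
  have h2 : f ^ 2 ≤ μ.real (lrCross (-(2 * s)) (2 * s) s (2 * s) ∩ lrCross (-(2 * s)) (2 * s) (-(2 * s)) (-s)) := by
    nlinarith
  have h3 : f ^ 3 ≤ μ.real (lrCross (-(2 * s)) (2 * s) s (2 * s) ∩ lrCross (-(2 * s)) (2 * s) (-(2 * s)) (-s) ∩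
      tbCross (-(2 * s)) (-s) (-(2 * s)) (2 * s)) := by
    nlinarith [mul_le_mul h2 le_rfl hf0 measureReal_nonneg]
  have h4 : f ^ 4 ≤ μ.real (lrCross (-(2 * s)) (2 * s) s (2 * s) ∩ lrCross (-(2 * s)) (2 * s) (-(2 * s)) (-s) ∩
      tbCross (-(2 * s)) (-s) (-(2 * s)) (2 * s) ∩ tbCross s (2 * s) (-(2 * s)) (2 * s)) := by
    nlinarith [mul_le_mul h3 le_rfl hf0 measureReal_nonneg]
  exact h4

/-- **The hooks of the annulus event.**  On `A_s` there are weak-black continua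
`U_L ⊆ [-2s, 0] × [-2s, 2s]` and `U_R ⊆ [0, 2s] × [-2s, 2s]`, each with a point of the imaginary
axis at height `≥ s` and one at height `≤ -s`, and the top crossing `K_T ⊆ [-2s, 2s] × [s, 2s]`
meets both (so `U_L ∪ K_T ∪ U_R` is connected).  This is the part of "there is a black circuit in
`A_{s,2s}`" used in Lemmas 3.1, 3.2. [cite: Tassion2016, Lemma 3.1 and proof of Lemma 3.2] -/
theorem exists_hooks_of_mem_annEv {ω : Ω₂} (hs : 0 < s) (hω : ω ∈ annEv s) :
    ∃ U_L U_R K_T : Set ℂ,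
      (U_L ⊆ blackRegion ((ω.1 : PointConfig ℂ) : Set ℂ) ((ω.2 : PointConfig ℂ) : Set ℂ) ∩
        cRect (-(2 * s)) 0 (-(2 * s)) (2 * s) ∧ IsCompact U_L ∧ IsPreconnected U_L ∧
        (∃ q ∈ U_L, q.re = 0 ∧ s ≤ q.im) ∧ (∃ q ∈ U_L, q.re = 0 ∧ q.im ≤ -s)) ∧
      (U_R ⊆ blackRegion ((ω.1 : PointConfig ℂ) : Set ℂ) ((ω.2 : PointConfig ℂ) : Set ℂ) ∩
        cRect 0 (2 * s) (-(2 * s)) (2 * s) ∧ IsCompact U_R ∧ IsPreconnected U_R ∧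
        (∃ q ∈ U_R, q.re = 0 ∧ s ≤ q.im) ∧ (∃ q ∈ U_R, q.re = 0 ∧ q.im ≤ -s)) ∧
      (K_T ⊆ blackRegion ((ω.1 : PointConfig ℂ) : Set ℂ) ((ω.2 : PointConfig ℂ) : Set ℂ) ∩
        cRect (-(2 * s)) (2 * s) s (2 * s) ∧ IsCompact K_T ∧ IsPreconnected K_T ∧
        (∃ q ∈ K_T, q.re = -(2 * s)) ∧ (∃ q ∈ K_T, q.re = 2 * s)) ∧
      (U_L ∩ K_T).Nonempty ∧ (U_R ∩ K_T).Nonempty := by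
  obtain ⟨⟨⟨hT, hBo⟩, hL⟩, hR⟩ := hω
  obtain ⟨K_T, hKT, hKTc, hKTp, ⟨aT, haT, haTre⟩, ⟨bT, hbT, hbTre⟩⟩ := hT
  obtain ⟨K_B, hKB, hKBc, hKBp, ⟨aB, haB, haBre⟩, ⟨bB, hbB, hbBre⟩⟩ := hBo
  obtain ⟨V_L, hVL, hVLc, hVLp, ⟨pL, hpL, hpLim⟩, ⟨qL, hqL, hqLim⟩⟩ := hL
  obtain ⟨V_R, hVR, hVRc, hVRp, ⟨pR, hpR, hpRim⟩, ⟨qR, hqR, hqRim⟩⟩ := hR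
  have h2s : -(2 * s) ≤ 0 := by linarith
  have h2s' : (0 : ℝ) ≤ 2 * s := by linarith
  -- sub-continua of the top and bottom crossings on either side of the imaginary axis
  obtain ⟨T₁, hT₁, hT₁c, hT₁p, hT₁strip, hT₁a, hT₁b⟩ := exists_subcontinuum_between_lines h2s hKTc hKTp
    ⟨aT, haT, haTre.le⟩ ⟨bT, hbT, by rw [hbTre]; linarith⟩
  obtain ⟨T₂, hT₂, hT₂c, hT₂p, hT₂strip, hT₂a, hT₂b⟩ := exists_subcontinuum_between_lines h2s' hKTc hKTp
    ⟨aT, haT, by rw [haTre]; linarith⟩ ⟨bT, hbT, hbTre.ge⟩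
  obtain ⟨B₁, hB₁, hB₁c, hB₁p, hB₁strip, hB₁a, hB₁b⟩ := exists_subcontinuum_between_lines h2s hKBc hKBp
    ⟨aB, haB, haBre.le⟩ ⟨bB, hbB, by rw [hbBre]; linarith⟩
  obtain ⟨B₂, hB₂, hB₂c, hB₂p, hB₂strip, hB₂a, hB₂b⟩ := exists_subcontinuum_between_lines h2s' hKBc hKBp
    ⟨aB, haB, by rw [haBre]; linarith⟩ ⟨bB, hbB, hbBre.ge⟩
  -- bands
  have hT₁band : ∀ w ∈ T₁, s ≤ w.im ∧ w.im ≤ 2 * s := fun w hw => (mem_cRect.1 (hKT (hT₁ hw)).2).2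
  have hT₂band : ∀ w ∈ T₂, s ≤ w.im ∧ w.im ≤ 2 * s := fun w hw => (mem_cRect.1 (hKT (hT₂ hw)).2).2
  have hB₁band : ∀ w ∈ B₁, -(2 * s) ≤ w.im ∧ w.im ≤ -s := fun w hw => (mem_cRect.1 (hKB (hB₁ hw)).2).2
  have hB₂band : ∀ w ∈ B₂, -(2 * s) ≤ w.im ∧ w.im ≤ -s := fun w hw => (mem_cRect.1 (hKB (hB₂ hw)).2).2
  have hVLstrip : ∀ w ∈ V_L, -(2 * s) ≤ w.re ∧ w.re ≤ -s := fun w hw => (mem_cRect.1 (hVL hw).2).1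
  have hVRstrip : ∀ w ∈ V_R, s ≤ w.re ∧ w.re ≤ 2 * s := fun w hw => (mem_cRect.1 (hVR hw).2).1
  -- the four plus-position intersections
  obtain ⟨w₁, hw₁V, hw₁T⟩ : (V_L ∩ T₁).Nonempty := by
    obtain ⟨x, hx, hxre⟩ := hT₁a; obtain ⟨y, hy, hyre⟩ := hT₁b
    exact inter_nonempty_of_plus (by linarith) (by linarith) hVLc hVLp hVLstrip
      ⟨pL, hpL, by rw [hpLim]; linarith⟩ ⟨qL, hqL, hqLim.ge⟩ hT₁c hT₁p hT₁band
      ⟨x, hx, hxre.le⟩ ⟨y, hy, by rw [hyre]; linarith⟩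
  obtain ⟨w₂, hw₂V, hw₂B⟩ : (V_L ∩ B₁).Nonempty := by
    obtain ⟨x, hx, hxre⟩ := hB₁a; obtain ⟨y, hy, hyre⟩ := hB₁b
    exact inter_nonempty_of_plus (by linarith) (by linarith) hVLc hVLp hVLstrip
      ⟨pL, hpL, hpLim.le⟩ ⟨qL, hqL, by rw [hqLim]; linarith⟩ hB₁c hB₁p hB₁band
      ⟨x, hx, hxre.le⟩ ⟨y, hy, by rw [hyre]; linarith⟩
  obtain ⟨w₃, hw₃V, hw₃T⟩ : (V_R ∩ T₂).Nonempty := by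
    obtain ⟨x, hx, hxre⟩ := hT₂a; obtain ⟨y, hy, hyre⟩ := hT₂b
    exact inter_nonempty_of_plus (by linarith) (by linarith) hVRc hVRp hVRstrip
      ⟨pR, hpR, by rw [hpRim]; linarith⟩ ⟨qR, hqR, hqRim.ge⟩ hT₂c hT₂p hT₂band
      ⟨x, hx, by rw [hxre]; linarith⟩ ⟨y, hy, hyre.ge⟩
  obtain ⟨w₄, hw₄V, hw₄B⟩ : (V_R ∩ B₂).Nonempty := by
    obtain ⟨x, hx, hxre⟩ := hB₂a; obtain ⟨y, hy, hyre⟩ := hB₂b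
    exact inter_nonempty_of_plus (by linarith) (by linarith) hVRc hVRp hVRstrip
      ⟨pR, hpR, hpRim.le⟩ ⟨qR, hqR, by rw [hqRim]; linarith⟩ hB₂c hB₂p hB₂band
      ⟨x, hx, by rw [hxre]; linarith⟩ ⟨y, hy, hyre.ge⟩
  have hblack := fun (w : ℂ) (hw : w ∈ K_T) => (hKT hw).1
  refine ⟨(V_L ∪ T₁) ∪ B₁, (V_R ∪ T₂) ∪ B₂, K_T, ⟨?_, (hVLc.union hT₁c).union hB₁c,
    (hVLp.union w₁ hw₁V hw₁T hT₁p).union w₂ (Or.inl hw₂V) hw₂B hB₁p, ?_, ?_⟩,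
    ⟨?_, (hVRc.union hT₂c).union hB₂c, (hVRp.union w₃ hw₃V hw₃T hT₂p).union w₄ (Or.inl hw₄V) hw₄B hB₂p,
    ?_, ?_⟩, ⟨hKT, hKTc, hKTp, ⟨aT, haT, haTre⟩, ⟨bT, hbT, hbTre⟩⟩,
    ⟨w₁, Or.inl (Or.inr hw₁T), hT₁ hw₁T⟩, ⟨w₃, Or.inl (Or.inr hw₃T), hT₂ hw₃T⟩⟩
  · rintro w ((hw | hw) | hw)
    · refine ⟨(hVL hw).1, ?_⟩
      have h := mem_cRect.1 (hVL hw).2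
      exact mem_cRect.2 ⟨⟨h.1.1, by linarith [h.1.2]⟩, h.2⟩
    · refine ⟨(hKT (hT₁ hw)).1, ?_⟩
      have h := hT₁band w hw
      exact mem_cRect.2 ⟨hT₁strip w hw, by linarith [h.1], h.2⟩
    · refine ⟨(hKB (hB₁ hw)).1, ?_⟩
      have h := hB₁band w hw
      exact mem_cRect.2 ⟨hB₁strip w hw, h.1, by linarith [h.2]⟩
  · obtain ⟨y, hy, hyre⟩ := hT₁b
    exact ⟨y, Or.inl (Or.inr hy), hyre, (hT₁band y hy).1⟩
  · obtain ⟨y, hy, hyre⟩ := hB₁b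
    exact ⟨y, Or.inr hy, hyre, (hB₁band y hy).2⟩
  · rintro w ((hw | hw) | hw)
    · refine ⟨(hVR hw).1, ?_⟩
      have h := mem_cRect.1 (hVR hw).2
      exact mem_cRect.2 ⟨⟨by linarith [h.1.1], h.1.2⟩, h.2⟩
    · refine ⟨(hKT (hT₂ hw)).1, ?_⟩
      have h := hT₂band w hw
      exact mem_cRect.2 ⟨hT₂strip w hw, by linarith [h.1], h.2⟩
    · refine ⟨(hKB (hB₂ hw)).1, ?_⟩
      have h := hB₂band w hw
      exact mem_cRect.2 ⟨hB₂strip w hw, h.1, by linarith [h.2]⟩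
  · obtain ⟨x, hx, hxre⟩ := hT₂a
    exact ⟨x, Or.inl (Or.inr hx), hxre, (hT₂band x hx).1⟩
  · obtain ⟨x, hx, hxre⟩ := hB₂a
    exact ⟨x, Or.inr hx, hxre, (hB₂band x hx).2⟩

end Annulus

end Literature.Probability.Percolation
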